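import Mathlib
import Summits.Ventures.PercRepro2.SwOutPureJunction
import Summits.Ventures.PercRepro2.SwOutBridge

/-!
# The pure junctions adjacent to `h` are bridge junctions (blind cell PercRepro2, night-4 g28,
2026-08-28; proofs/NIGHT4-G28.md §4 — the subsumption B7 ⊆ B9)

A pure junction `u` of `PureJunctions ends U h J o` is separated from `h` by its (at most one)
edge `h–u` inside `G[U]`: in `G[U] − e₀` the edges `h–u` are all absent, so the sphere lemma —
restated for the RED cluster alone (`PureJunctions.notMem_cluster_h_of_blue_hu'`: the landed
form asks for the whole hull inside `U`, which the all-open colouring `cutConfig U e₀` does not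
satisfy; its proof only ever used the red cluster) — puts `u` outside the cluster of `h` in
`G[U] − e₀`.  Hence every `PureJunctions` region satisfies the hypothesis of `rigidOK_of_bridges`
(**`PureJunctions.bridges`**), and the theorems of SwOutPureJunction are corollaries of the bridge
theorem (`PureJunctions.rigidOK_viaBridges`, **`sw_of_pureJunctions_viaBridges`**).
-/

namespace Summit.Ventures.PercRepro2

namespace LocRows

open Hull

variable {V : Type*} {E : Type*} [Fintype E] [DecidableEq E]

open scoped Classical

variable {ends : E → Sym2 V} {U : Set V} {h o : V} {J : Set V}

omit [Fintype E] in
/-- The cluster of `h` in `G[U] − e₀` lies in `U` (when `h ∈ U`). -/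
lemma cluster_cut_subset_U {e₀ : E} (hh : h ∈ U) :
    cluster ends (cutConfig ends U e₀) h ⊆ U := by
  refine cluster_cut_subset hh ?_
  intro e x y hexy hin _ _
  obtain ⟨a, ha, b, hb, hab⟩ := hin
  rw [hexy, Sym2.eq_iff] at hab
  rcases hab with ⟨_, h2⟩ | ⟨_, h2⟩
  · rw [h2]; exact hb
  · rw [h2]; exact ha

section Sphere

variable (hJ : PureJunctions ends U h J o)
include hJ

omit [Fintype E] [DecidableEq E] in
/-- **The sphere lemma for the red cluster alone**: at a configuration whose RED cluster of `h`
lies in `U` and whose edges `h–u` are all blue, the junction `u` is not in the red cluster of `h`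
(the proof of the landed `notMem_cluster_h_of_blue_hu`, which used only the red cluster). -/
theorem PureJunctions.notMem_cluster_h_of_blue_hu' {ζ : Config E}
    (hT : cluster ends ζ h ⊆ U) {u : V} (hu : u ∈ J)
    (hblue : ∀ e, ends e = s(h, u) → ζ e = false) : u ∉ cluster ends ζ h := by
  intro huT
  have key : cluster ends ζ h ⊆ {y | y ∈ cluster ends ζ h ∧ y ∉ sphereJ ends U h J u} := by
    intro y hy
    refine mem_of_conn_of_closed (ends := ends) (ω := ζ) ?_
      ⟨mem_cluster_self _ _ _, hJ.h_notMem_sphere hu⟩ hy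
    rintro a ⟨haT, haS⟩ b hab
    have hbT : b ∈ cluster ends ζ h := mem_cluster_of_adj haT hab
    refine ⟨hbT, ?_⟩
    obtain ⟨_, e, he, hends⟩ := openGraph_adj.1 hab
    have haU : a ∈ U := hT haT
    rintro (hb | ⟨e₁, x, hex, hxU, hxh, hxJ, hb⟩)
    · rw [Set.mem_singleton_iff] at hb
      subst hb
      by_cases hah : a = h
      · subst hah
        have := hblue e hends
        rw [he] at this
        exact Bool.noConfusion this
      by_cases haJ : a ∈ J
      · have hau : a ≠ b := fun hab' => haS (Or.inl hab')
        exact hJ.no_JJ a haJ b hu hau e hends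
      · exact haS (Or.inr ⟨e, a, ends_swap hends, haU, hah, haJ,
          mem_cluster_self _ _ _⟩)
    · by_cases hah : a = h
      · subst hah
        exact (hJ.pure u hu e₁ x hex hxU hxh hxJ b hb).1 e hends
      by_cases haJ : a ∈ J
      · have hau : a ≠ u := fun hau => haS (Or.inl hau)
        exact (hJ.pure u hu e₁ x hex hxU hxh hxJ b hb).2 a haJ hau e hends
      · have haU' : a ∈ U \ insert h J := ⟨haU, by simp [hah, haJ]⟩
        have hbU' : b ∈ U \ insert h J := compJ_subset_sdiff' hxU hxh hxJ hb
        exact haS (Or.inr ⟨e₁, x, hex, hxU, hxh, hxJ,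
          mem_compJ_of_edge hb hbU' haU' (ends_swap hends)⟩)
  exact (key huT).2 (Or.inl rfl)

omit [Fintype E] in
/-- **A pure junction is a bridge junction**: it has no edge, or it is separated from `h` by one
edge of `G[U]` (its edge `h–u`, or any of its edges when it has none to `h`). -/
theorem PureJunctions.sep {u : V} (hu : u ∈ J) (hh : h ∈ U) :
    (∀ e, u ∉ ends e) ∨ ∃ e₀, u ∉ cluster ends (cutConfig ends U e₀) h := by
  by_cases hE : ∃ e, u ∈ ends e
  · obtain ⟨e₁, he₁⟩ := hE
    right
    -- `e₀` = the edge `h–u` if there is one, else `e₁`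
    by_cases hhu : ∃ e, ends e = s(h, u)
    · obtain ⟨e₀, he₀⟩ := hhu
      refine ⟨e₀, hJ.notMem_cluster_h_of_blue_hu' (cluster_cut_subset_U hh) hu ?_⟩
      intro e he
      have : e = e₀ := hJ.hu_unique u hu e e₀ he he₀
      subst this
      simp [cutConfig]
    · refine ⟨e₁, hJ.notMem_cluster_h_of_blue_hu' (cluster_cut_subset_U hh) hu ?_⟩
      intro e he
      exact absurd ⟨e, he⟩ hhu
  · left
    intro e he
    exact hE ⟨e, he⟩

omit [Fintype E] in
/-- **The pure junctions satisfy the bridge hypothesis.** -/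
theorem PureJunctions.bridges (hh : h ∈ U) :
    ∀ x ∈ U, x ≠ h → x ≠ o →
      (∃ e y, ends e = s(x, y) ∧ y ∉ U) ∨ (∀ e, x ∉ ends e) ∨
        ∃ e₀, x ∉ cluster ends (cutConfig ends U e₀) h := by
  intro x hxU hxh hxo
  by_cases hxJ : x ∈ J
  · rcases hJ.sep hxJ hh with hiso | hsep
    · exact Or.inr (Or.inl hiso)
    · exact Or.inr (Or.inr hsep)
  · rcases hJ.hout x hxU hxh hxo hxJ with hout | hiso
    · exact Or.inl hout
    · exact Or.inr (Or.inl hiso)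

/-- The class theorem of the pure junctions as a corollary of the bridge theorem. -/
theorem PureJunctions.rigidOK_viaBridges {l : V} (hl : l ∉ U) (hloop : ∀ e, ends e ≠ s(h, h))
    (hh : h ∈ U) (ξ : Config E) : RigidOK ends l h o U ξ :=
  rigidOK_of_bridges hl hloop (hJ.bridges hh) ξ

end Sphere

/-- **Row (SW) on every graph with pure junctions adjacent to `h`, via the bridge theorem.** -/
theorem sw_of_pureJunctions_viaBridges {l : V} (hlh : l ≠ h) (hloop : ∀ e, ends e ≠ s(h, h))
    (hJ : PureJunctions ends ({l}ᶜ) h J o) : Sw ends l h o :=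
  sw_of_swAll ends (swAll_of_reducible l h o hlh (Reducible.base ends ({l}ᶜ) fun ξ =>
    hJ.rigidOK_viaBridges (by simp) hloop (by simpa using hlh.symm) ξ))

end LocRows

end Summit.Ventures.PercRepro2
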